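import Literature.NumberTheory.LFunctions.RealPointNonnegativityClassNumberBound
import HarnessLib

/-!
# The exceptional character is NEGATIVE left of its Siegel zero, kernel: under a Siegel zero of quality
# `η ≳ log²d`, `L(σ, χ) < 0` — hence no real zero — on an explicit window `[1 − κ₂/log(√d/2), 1 − κ₁/log(√d/2)]`

Topic `Literature/NumberTheory/LFunctions` (namespace `Literature.NumberTheory.LFunctions`, sub-namespace
`RealPointExit`, continuing `RealPointNonnegativityClassNumberBound.lean`). Everything in this file is PROVED
(theorems only; no definition, no named fact, debt 0). Cell `parity-realchar` (SIEGEL INSTRUMENT, conditionals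
column (3)), Direction I: what a Siegel zero forces on the REAL AXIS for its own `L`-function — a kernel shadow of
the Deuring–Heilbronn phenomenon restricted to real zeros of the exceptional character (the printed Deuring–Heilbronn
theorems of the column, `BGTZ2025.corollary11`, `jutila1977_theorem2`, `stopple2012_theorem`, are named facts; this
file is fact-free and concerns only real points).

## Statements

`χ` odd real primitive mod `d`, `K` any quadratic field with `d_K = −d`, `y = √d/2`, `L = log y`. The one-point exit
of `RealPointNonnegativityClassNumberBound.lean` at `σ = 1 − κ/L` (`0 < κ ≤ L/4`), with `y^σ = y e^{−κ}`,
`y^{1−σ} = e^{κ}` and the elementary estimates `L/(L−2κ) ∈ [1,2]`, `L/(2L−2κ) ≤ 2/3`,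
`σ(1−σ) ∈ [3κ/(4L), κ/L]`, reads:

* `classNumber_ge_of_LFunction_nonneg_at` **`0 ≤ Re L(1 − κ/L, χ)` ⇒ `h_K ≥ κe^{−κ}·y/(2L) − 2e^{κ} + ¾`**
  (`κ = 1` is the Hecke point of the previous file, with `¾ − 2e` in place of `−5`);
* `exists_realZero_of_classNumber_lt_at` **`h_K < κe^{−κ}y/(2L) − 2e^{κ} + ¾` ⇒ `Re L(1 − κ/L, χ) < 0` and a real
  zero in `(1 − κ/L, 1)`**;
* under a Tao–Teräväinen Siegel zero of quality `η ≥ 40` (kernel I.1 ceiling `h_K ≤ √d log d/(πη) = 2y log d/(πη)`,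
  tree `SiegelZeroClassNumber.classNumber_le_of_isSiegelZero_odd_of_forty_le`):
  `LFunction_neg_at_of_isSiegelZero` **`η·(κe^{−κ}y/(2L) − 2e^{κ} + ¾) > 2y log d/π` ⇒ `Re L(1 − κ/L, χ) < 0`**;
  `LFunction_neg_on_window_of_isSiegelZero`: if `1 ≤ κ₁ ≤ κ₂ ≤ L/4` and the inequality holds at `κ₂`, then
  **`Re L(β, χ) < 0` (so `L(β, χ) ≠ 0`) for every `β ∈ [1 − κ₂/L, 1 − κ₁/L]`** (`κe^{−κ}` decreases and `e^{κ}`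
  increases on `[1, ∞)`);
* the numeric instance `LFunction_neg_on_window_of_isSiegelZero_of_three_log_sq`: **for `η ≥ 3 log²d` (and
  `y ≥ e⁸`, `y ≥ 272 log d`, both true once `d ≥ 1.3·10⁸`) the exceptional `L(s, χ)` is negative on
  `[1 − 2/log(√d/2), 1 − 1/log(√d/2)] ≈ [1 − 4/log d, 1 − 2/log d]`** — the Siegel zero `β₀ = 1 − 1/(η log d)` has no
  companion real zero at that scale (isolation from the left), and `L(s, χ)` changes sign an odd number of times
  between the window and `1`.

LABEL (cell rule): conditionals I (Siegel zero ⇒ negativity window / real-zero isolation for the exceptional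
character), kernel, fact-free. WHAT THIS IS NOT: not the Deuring–Heilbronn theorem (complex zeros, other characters,
the `log`-scale repulsion are untouched); no claim that a Siegel zero exists; nothing here bears on parity (H5).

## References (context; nothing is cited as the source of a named fact)

* [IwaniecConversations2006] §4–§5 (Eisenstein-series lower bounds; Deuring's argument "small class number ⇒ the
  principal form dominates").
* [MontgomeryVaughan2007] §11.2 Theorem 11.4 (Hecke) and §11.5 notes (Deuring 1933, Heilbronn 1934).
* [TaoTeravainen2021] Definition 1.4 (`IsSiegelZero`).
-/

noncomputable section

open Complex Filter Topology Set
open Literature.Barriers.Parity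
open Literature.NumberTheory.QuadraticFields Literature.NumberTheory.QuadraticFields.Quadratic
open _root_.NumberField Module

namespace Literature.NumberTheory.LFunctions

namespace RealPointExit

/-! ### The one-point bound at `σ = 1 − κ/log y` -/

/-- Numerics at `σ = 1 − κ/L`, `L = log y ≥ 4κ > 0`:
`σ(1−σ)[2y^σ(1/(2σ−1) − 1/(2σ)) − 2y^{1−σ}(1/(2−2σ) + 1/(2σ−1)) − 1] ≥ κe^{−κ}y/(2L) − 2e^{κ} − ¼`. [folklore] -/
private theorem point_bound {y κ : ℝ} (hκ : 0 < κ) (hL : 4 * κ ≤ Real.log y) (hy1 : 1 < y) :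
    κ * Real.exp (-κ) * y / (2 * Real.log y) - 2 * Real.exp κ - 1 / 4 ≤
      (1 - κ / Real.log y) * (1 - (1 - κ / Real.log y)) *
        (2 * y ^ (1 - κ / Real.log y) *
            (1 / (2 * (1 - κ / Real.log y) - 1) - 1 / (2 * (1 - κ / Real.log y))) -
          2 * y ^ (1 - (1 - κ / Real.log y)) *
            (1 / (2 - 2 * (1 - κ / Real.log y)) + 1 / (2 * (1 - κ / Real.log y) - 1)) - 1) := by
  have hy0 : 0 < y := by linarith
  set L := Real.log y with hLdef
  have hL0 : 0 < L := by linarith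
  -- `y^{κ/L} = e^{κ}`, `y^{1 − κ/L} = y e^{−κ}`
  have hpow1 : y ^ (κ / L) = Real.exp κ := by
    rw [Real.rpow_def_of_pos hy0, ← hLdef]
    congr 1
    field_simp
  have hpow2 : y ^ (1 - κ / L) = y * Real.exp (-κ) := by
    rw [Real.rpow_sub hy0, Real.rpow_one, hpow1, Real.exp_neg, div_eq_mul_inv]
  have e1 : (1 : ℝ) - (1 - κ / L) = κ / L := by ring
  rw [e1, hpow1, hpow2]
  set e := Real.exp κ with hedef
  set e' := Real.exp (-κ) with he'def
  have he0 : 0 < e := Real.exp_pos κ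
  have he'0 : 0 < e' := Real.exp_pos (-κ)
  -- simplify the σ-expressions
  have eσ1 : 2 * (1 - κ / L) - 1 = (L - 2 * κ) / L := by field_simp; ring
  have eσ2 : 2 * (1 - κ / L) = (2 * L - 2 * κ) / L := by field_simp
  have eσ3 : 2 - 2 * (1 - κ / L) = 2 * κ / L := by field_simp; ring
  rw [eσ1, eσ3, eσ2]
  have hL2 : 0 < L - 2 * κ := by linarith
  have hL22 : 0 < 2 * L - 2 * κ := by linarith
  have r1 : 1 / ((L - 2 * κ) / L) = L / (L - 2 * κ) := by rw [one_div_div]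
  have r2 : 1 / ((2 * L - 2 * κ) / L) = L / (2 * L - 2 * κ) := by rw [one_div_div]
  have r3 : 1 / (2 * κ / L) = L / (2 * κ) := by rw [one_div_div]
  rw [r1, r2, r3]
  -- bounds: `L/(L−2κ) ∈ [1, 2]`, `L/(2L−2κ) ≤ 2/3`
  have b1 : 1 ≤ L / (L - 2 * κ) := by rw [le_div_iff₀ hL2]; linarith
  have b2 : L / (2 * L - 2 * κ) ≤ 2 / 3 := by rw [div_le_div_iff₀ hL22 (by norm_num)]; linarith
  have b3 : L / (L - 2 * κ) ≤ 2 := by rw [div_le_iff₀ hL2]; linarith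
  have hye : 0 < y * e' := mul_pos hy0 he'0
  have hA : 2 * (y * e') * (1 / 3) ≤ 2 * (y * e') * (L / (L - 2 * κ) - L / (2 * L - 2 * κ)) := by
    apply mul_le_mul_of_nonneg_left _ (by positivity); linarith
  have hB : 2 * e * (L / (2 * κ) + L / (L - 2 * κ)) ≤ 2 * e * (L / (2 * κ) + 2) := by
    apply mul_le_mul_of_nonneg_left _ (by positivity); linarith
  -- `σ(1−σ) = (1 − κ/L)(κ/L) ∈ [3κ/(4L), κ/L]`
  have hκL : κ / L ≤ 1 / 4 := by
    rw [div_le_div_iff₀ hL0 (by norm_num)]; linarith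
  have hκL0 : 0 < κ / L := by positivity
  have hs : (1 - κ / L) * (κ / L) ≤ κ / L := by nlinarith
  have hs' : 3 / 4 * (κ / L) ≤ (1 - κ / L) * (κ / L) := by nlinarith
  set A' := 2 * (y * e') * (L / (L - 2 * κ) - L / (2 * L - 2 * κ)) with hA'
  set B' := 2 * e * (L / (2 * κ) + L / (L - 2 * κ)) with hB'
  set s := (1 - κ / L) * (κ / L) with hsdef
  have hs0 : 0 ≤ s := le_trans (by positivity) hs'
  have hA'0 : 0 ≤ A' := le_trans (by positivity) hA
  have hB'0 : 0 ≤ B' + 1 := by rw [hB']; positivity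
  have hprod : 3 / 4 * (κ / L) * A' - κ / L * (B' + 1) ≤ s * (A' - B' - 1) := by
    have h1 : 3 / 4 * (κ / L) * A' ≤ s * A' := mul_le_mul_of_nonneg_right hs' hA'0
    have h2 : s * (B' + 1) ≤ κ / L * (B' + 1) := mul_le_mul_of_nonneg_right hs hB'0
    nlinarith
  -- `(3/4)(κ/L)·A' ≥ κ e' y/(2L)` and `(κ/L)(B' + 1) ≤ e + (4e+1)κ/L ≤ e + (4e+1)/4`
  have hT1 : κ * e' * y / (2 * L) ≤ 3 / 4 * (κ / L) * A' := by
    have : κ * e' * y / (2 * L) = 3 / 4 * (κ / L) * (2 * (y * e') * (1 / 3)) := by field_simp; ring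
    rw [this]
    exact mul_le_mul_of_nonneg_left hA (by positivity)
  have hT2 : κ / L * (B' + 1) ≤ e + (4 * e + 1) / 4 := by
    have h1 : κ / L * (B' + 1) ≤ κ / L * (2 * e * (L / (2 * κ) + 2) + 1) :=
      mul_le_mul_of_nonneg_left (by linarith) hκL0.le
    have h2 : κ / L * (2 * e * (L / (2 * κ) + 2) + 1) = e + (4 * e + 1) * (κ / L) := by
      field_simp
      ring
    have h3 : (4 * e + 1) * (κ / L) ≤ (4 * e + 1) * (1 / 4) :=
      mul_le_mul_of_nonneg_left hκL (by positivity)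
    linarith
  have : κ * Real.exp (-κ) * y / (2 * L) = κ * e' * y / (2 * L) := by rw [he'def]
  rw [this]
  linarith

variable {K : Type*} [Field K] [NumberField K]

/-- `4κ ≤ log(√d/2)` with `κ > 0` forces `√d/2 > 1`, hence `d > 4`. [folklore] -/
private theorem four_lt_of_log {d : ℕ} {κ : ℝ} (hκ : 0 < κ) (hL : 4 * κ ≤ Real.log (Real.sqrt d / 2)) :
    1 < Real.sqrt d / 2 ∧ 4 < d := by
  have hlog : 0 < Real.log (Real.sqrt d / 2) := by linarith
  have hy1 : 1 < Real.sqrt d / 2 := by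
    by_contra hcon
    push Not at hcon
    have := Real.log_nonpos (by positivity) hcon
    linarith
  refine ⟨hy1, ?_⟩
  by_contra hcon
  push Not at hcon
  have : Real.sqrt d ≤ Real.sqrt 4 := Real.sqrt_le_sqrt (by exact_mod_cast hcon)
  have h4 : Real.sqrt 4 = 2 := by
    rw [show (4 : ℝ) = 2 ^ 2 by norm_num, Real.sqrt_sq (by norm_num)]
  linarith

/-- **`0 ≤ Re L(1 − κ/log(√d/2), χ)` ⇒ `h_K ≥ κe^{−κ}·(√d/2)/(2 log(√d/2)) − 2e^{κ} + ¾`** for `0 < κ ≤ ¼ log(√d/2)`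
(`χ` odd real primitive mod `d`, `K` quadratic with `d_K = −d`): the one-point exit
`classNumber_ge_of_LFunction_ofReal_nonneg` at `σ = 1 − κ/log(√d/2)`. [cite: IwaniecConversations2006, §5]
[cite: MontgomeryVaughan2007, §11.2 Theorem 11.4] -/
theorem classNumber_ge_of_LFunction_nonneg_at (h2 : finrank ℚ K = 2) {d : ℕ} [NeZero d]
    (hdK : NumberField.discr K = -(d : ℤ)) {χ : DirichletCharacter ℂ d}
    (hprim : χ.IsPrimitive) (hquad : χ.IsQuadratic) (hodd : χ.Odd) {κ : ℝ} (hκ : 0 < κ)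
    (hL : 4 * κ ≤ Real.log (Real.sqrt d / 2))
    (hLχ : 0 ≤ (χ.LFunction ((1 - κ / Real.log (Real.sqrt d / 2) : ℝ) : ℂ)).re) :
    κ * Real.exp (-κ) * (Real.sqrt d / 2) / (2 * Real.log (Real.sqrt d / 2)) - 2 * Real.exp κ + 3 / 4 ≤
      (classNumber K : ℝ) := by
  obtain ⟨hy1, hd4⟩ := four_lt_of_log hκ hL
  set y := Real.sqrt d / 2 with hydef
  set L := Real.log y with hLdef
  have hL0 : 0 < L := by linarith
  have hσ : 1 / 2 < 1 - κ / L := by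
    have : κ / L ≤ 1 / 4 := by rw [div_le_div_iff₀ hL0 (by norm_num)]; linarith
    linarith
  have hσ1 : 1 - κ / L < 1 := by
    have : 0 < κ / L := by positivity
    linarith
  have hmain := classNumber_ge_of_LFunction_ofReal_nonneg h2 hdK hd4 hprim hquad hodd hσ hσ1 hLχ
  have hnum := point_bound hκ hL hy1
  rw [← hydef] at hmain
  rw [← hLdef] at hnum
  linarith

/-- **`h_K < κe^{−κ}(√d/2)/(2 log(√d/2)) − 2e^{κ} + ¾` ⇒ `Re L(1 − κ/log(√d/2), χ) < 0` and `L(s, χ)` has a real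
zero in `(1 − κ/log(√d/2), 1)`** (`0 < κ ≤ ¼ log(√d/2)`). [cite: IwaniecConversations2006, §5]
[cite: MontgomeryVaughan2007, §11.2 Theorem 11.4] -/
theorem exists_realZero_of_classNumber_lt_at (h2 : finrank ℚ K = 2) {d : ℕ} [NeZero d]
    (hdK : NumberField.discr K = -(d : ℤ)) {χ : DirichletCharacter ℂ d}
    (hprim : χ.IsPrimitive) (hquad : χ.IsQuadratic) (hodd : χ.Odd) {κ : ℝ} (hκ : 0 < κ)
    (hL : 4 * κ ≤ Real.log (Real.sqrt d / 2))
    (hh : (classNumber K : ℝ) <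
      κ * Real.exp (-κ) * (Real.sqrt d / 2) / (2 * Real.log (Real.sqrt d / 2)) - 2 * Real.exp κ + 3 / 4) :
    (χ.LFunction ((1 - κ / Real.log (Real.sqrt d / 2) : ℝ) : ℂ)).re < 0 ∧
      ∃ β : ℝ, 1 - κ / Real.log (Real.sqrt d / 2) < β ∧ β < 1 ∧ χ.LFunction β = 0 := by
  obtain ⟨hy1, hd4⟩ := four_lt_of_log hκ hL
  set y := Real.sqrt d / 2 with hydef
  set L := Real.log y with hLdef
  have hL0 : 0 < L := by linarith
  have hσ : 1 / 2 < 1 - κ / L := by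
    have : κ / L ≤ 1 / 4 := by rw [div_le_div_iff₀ hL0 (by norm_num)]; linarith
    linarith
  have hσ1 : 1 - κ / L < 1 := by
    have : 0 < κ / L := by positivity
    linarith
  refine exists_realZero_of_classNumber_lt h2 hdK hd4 hprim hquad hodd hσ hσ1 ?_
  have hnum := point_bound hκ hL hy1
  rw [← hLdef] at hnum
  rw [← hydef]
  linarith

/-! ### Under a Siegel zero: negativity at a point and on a window -/

/-- **A Siegel zero makes `L(1 − κ/log(√d/2), χ)` NEGATIVE** whenever
`η·(κe^{−κ}y/(2L) − 2e^{κ} + ¾) > 2y log d/π` (`y = √d/2`, `L = log y`, `0 < κ ≤ L/4`): `IsSiegelZero χ η` with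
`η ≥ 40` at an odd `χ` mod `d ≥ 10⁴` pins `h_K ≤ √d log d/(πη) = 2y log d/(πη)` (kernel I.1 ceiling), below the
one-point bound. [cite: TaoTeravainen2021, Definition 1.4] [cite: IwaniecConversations2006, §5] -/
theorem LFunction_neg_at_of_isSiegelZero {d : ℕ} [NeZero d] (hd : 10 ^ 4 ≤ d)
    {χ : DirichletCharacter ℂ d} {η : ℝ} (hS : IsSiegelZero χ η) (hodd : χ.Odd) (h40 : 40 ≤ η)
    {κ : ℝ} (hκ : 0 < κ) (hL : 4 * κ ≤ Real.log (Real.sqrt d / 2))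
    (hη : 2 * (Real.sqrt d / 2) * Real.log d / Real.pi <
      η * (κ * Real.exp (-κ) * (Real.sqrt d / 2) / (2 * Real.log (Real.sqrt d / 2)) - 2 * Real.exp κ + 3 / 4)) :
    (χ.LFunction ((1 - κ / Real.log (Real.sqrt d / 2) : ℝ) : ℂ)).re < 0 ∧
      ∃ β : ℝ, 1 - κ / Real.log (Real.sqrt d / 2) < β ∧ β < 1 ∧ χ.LFunction β = 0 := by
  have hprim := hS.1
  have hquad := hS.2.1
  obtain ⟨K, _i1, _i2, h2, hdK⟩ := exists_quadraticField_of_odd_primitive hprim hquad hodd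
  have hη0 : 0 < η := by linarith
  have hup := SiegelZeroClassNumber.classNumber_le_of_isSiegelZero_odd_of_forty_le h2 hdK hd hS hodd h40
  refine exists_realZero_of_classNumber_lt_at h2 hdK hprim hquad hodd hκ hL (lt_of_le_of_lt hup ?_)
  rw [show 1 / Real.pi * Real.sqrt d * Real.log d / η = 2 * (Real.sqrt d / 2) * Real.log d / Real.pi / η by ring,
    div_lt_iff₀ hη0]
  linarith

/-- `κe^{−κ}` decreases and `e^{κ}` increases on `[1, ∞)`: for `1 ≤ a ≤ b`, `b e^{−b} ≤ a e^{−a}`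
(`e^{b−a} ≥ 1 + (b − a) ≥ b/a`). [folklore] -/
private theorem mul_exp_neg_antitone {a b : ℝ} (ha : 1 ≤ a) (hab : a ≤ b) :
    b * Real.exp (-b) ≤ a * Real.exp (-a) := by
  have h1 : 1 + (b - a) ≤ Real.exp (b - a) := by
    have := Real.add_one_le_exp (b - a); linarith
  have h2 : b ≤ a * (1 + (b - a)) := by nlinarith
  have hea : 0 < Real.exp (-a) := Real.exp_pos _
  have heb : 0 < Real.exp (-b) := Real.exp_pos _
  -- `b e^{-b} ≤ a (1 + (b−a)) e^{-b} ≤ a e^{b−a} e^{−b} = a e^{−a}`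
  have h3 : b * Real.exp (-b) ≤ a * (1 + (b - a)) * Real.exp (-b) :=
    mul_le_mul_of_nonneg_right h2 heb.le
  have h4 : a * (1 + (b - a)) * Real.exp (-b) ≤ a * Real.exp (b - a) * Real.exp (-b) := by
    apply mul_le_mul_of_nonneg_right _ heb.le
    exact mul_le_mul_of_nonneg_left h1 (by linarith)
  have h5 : a * Real.exp (b - a) * Real.exp (-b) = a * Real.exp (-a) := by
    rw [mul_assoc, ← Real.exp_add]; ring_nf
  linarith

/-- **Negativity window under a Siegel zero.** If `1 ≤ κ₁ ≤ κ₂ ≤ ¼ log(√d/2)` and the point inequality of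
`LFunction_neg_at_of_isSiegelZero` holds at `κ₂`, then **`Re L(β, χ) < 0` — in particular `L(β, χ) ≠ 0` — for every
`β ∈ [1 − κ₂/log(√d/2), 1 − κ₁/log(√d/2)]`**: the bound `κe^{−κ}y/(2L) − 2e^{κ} + ¾` is smallest at `κ = κ₂` on
`[κ₁, κ₂]`. The exceptional `L`-function has no real zero on the window; its Siegel zero `1 − 1/(η log d)` lies to
the right of it. [cite: TaoTeravainen2021, Definition 1.4] [cite: IwaniecConversations2006, §5] -/
theorem LFunction_neg_on_window_of_isSiegelZero {d : ℕ} [NeZero d] (hd : 10 ^ 4 ≤ d)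
    {χ : DirichletCharacter ℂ d} {η : ℝ} (hS : IsSiegelZero χ η) (hodd : χ.Odd) (h40 : 40 ≤ η)
    {κ₁ κ₂ : ℝ} (hκ₁ : 1 ≤ κ₁) (hκ₁₂ : κ₁ ≤ κ₂) (hL : 4 * κ₂ ≤ Real.log (Real.sqrt d / 2))
    (hη : 2 * (Real.sqrt d / 2) * Real.log d / Real.pi <
      η * (κ₂ * Real.exp (-κ₂) * (Real.sqrt d / 2) / (2 * Real.log (Real.sqrt d / 2)) -
        2 * Real.exp κ₂ + 3 / 4))
    {β : ℝ} (hβ1 : 1 - κ₂ / Real.log (Real.sqrt d / 2) ≤ β) (hβ2 : β ≤ 1 - κ₁ / Real.log (Real.sqrt d / 2)) :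
    (χ.LFunction (β : ℂ)).re < 0 ∧ χ.LFunction (β : ℂ) ≠ 0 := by
  obtain ⟨hy1, -⟩ := four_lt_of_log (by linarith : (0 : ℝ) < κ₂) hL
  set y := Real.sqrt d / 2 with hydef
  set L := Real.log y with hLdef
  have hL0 : 0 < L := by linarith
  -- `β = 1 − κ/L` with `κ = (1 − β) L ∈ [κ₁, κ₂]`
  set κ : ℝ := (1 - β) * L with hκdef
  have hκ1 : κ₁ ≤ κ := by
    have : κ₁ / L ≤ 1 - β := by linarith
    rw [hκdef]
    have := mul_le_mul_of_nonneg_right this hL0.le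
    rwa [div_mul_cancel₀ _ hL0.ne'] at this
  have hκ2 : κ ≤ κ₂ := by
    have : 1 - β ≤ κ₂ / L := by linarith
    rw [hκdef]
    have := mul_le_mul_of_nonneg_right this hL0.le
    rwa [div_mul_cancel₀ _ hL0.ne'] at this
  have hκ0 : 0 < κ := by linarith
  have hβ : β = 1 - κ / L := by rw [hκdef]; field_simp; ring
  have hLκ : 4 * κ ≤ L := by linarith
  -- the point inequality at `κ` follows from the one at `κ₂`
  have hη0 : 0 < η := by linarith
  have hmono : κ₂ * Real.exp (-κ₂) * y / (2 * L) - 2 * Real.exp κ₂ + 3 / 4 ≤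
      κ * Real.exp (-κ) * y / (2 * L) - 2 * Real.exp κ + 3 / 4 := by
    have h1 := mul_exp_neg_antitone (le_trans hκ₁ hκ1) hκ2
    have h2 : Real.exp κ ≤ Real.exp κ₂ := Real.exp_le_exp.2 hκ2
    have hy0 : 0 < y := by linarith
    have h3 : κ₂ * Real.exp (-κ₂) * y / (2 * L) ≤ κ * Real.exp (-κ) * y / (2 * L) := by
      rw [mul_div_assoc, mul_div_assoc]
      exact mul_le_mul_of_nonneg_right h1 (by positivity)
    linarith
  have hη' : 2 * y * Real.log d / Real.pi <
      η * (κ * Real.exp (-κ) * y / (2 * L) - 2 * Real.exp κ + 3 / 4) :=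
    lt_of_lt_of_le hη (mul_le_mul_of_nonneg_left hmono hη0.le)
  have h := (LFunction_neg_at_of_isSiegelZero hd hS hodd h40 hκ0 hLκ hη').1
  rw [← hβ] at h
  refine ⟨h, fun h0 => ?_⟩
  rw [h0, Complex.zero_re] at h
  exact lt_irrefl _ h

/-- Numerics: `2e^{−2} > 0.2706`, `e² < 7.3891`, `2/π < 0.6367`. [folklore] -/
private theorem numerics_two :
    0.2706 < 2 * Real.exp (-2) ∧ Real.exp 2 < 7.3891 ∧ 2 / Real.pi < 0.6367 := by
  have he := Real.exp_one_lt_d9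
  have he' := Real.exp_one_gt_d9
  have h2 : Real.exp 2 = Real.exp 1 ^ 2 := by rw [← Real.exp_nat_mul]; norm_num
  have hup : Real.exp 2 < 7.3891 := by rw [h2]; nlinarith
  refine ⟨?_, hup, ?_⟩
  · rw [Real.exp_neg]
    have hpos : 0 < Real.exp 2 := Real.exp_pos 2
    rw [show 2 * (Real.exp 2)⁻¹ = 2 / Real.exp 2 by ring, lt_div_iff₀ hpos]
    nlinarith
  · rw [div_lt_iff₀ Real.pi_pos]
    have := Real.pi_gt_d6
    linarith

/-- **The `3 log²d` instance.** For an odd `χ` mod `d` with `y = √d/2 ≥ e⁸` and `y ≥ 272 log d` (both hold once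
`d ≥ 1.3·10⁸`) carrying a Siegel zero of quality **`η ≥ 3 log²d`** (and `η ≥ 40`): **`Re L(β, χ) < 0` for every
`β ∈ [1 − 2/log(√d/2), 1 − 1/log(√d/2)]`** (`≈ [1 − 4/log d, 1 − 2/log d]`) — the exceptional `L`-function is
negative, hence zero-free, on that window, while its Siegel zero sits at `1 − 1/(η log d) > 1 − 1/(3 log³d)`.
(Window `κ ∈ [1, 2]`: the point inequality at `κ₂ = 2` reads `η(2e^{−2}y/(2L) − 2e² + ¾) > 2y log d/π`; with
`L ≤ ½ log d`, `2e^{−2} > 0.2706`, `2e² < 14.78`, `14.03 ≤ 0.0516·y/log d` and `2/π < 0.6367` it follows from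
`η ≥ 3 log²d`.) [cite: TaoTeravainen2021, Definition 1.4] [cite: IwaniecConversations2006, §5] -/
theorem LFunction_neg_on_window_of_isSiegelZero_of_three_log_sq {d : ℕ} [NeZero d] (hd : 10 ^ 4 ≤ d)
    (hy8 : Real.exp 8 ≤ Real.sqrt d / 2) (hy272 : 272 * Real.log d ≤ Real.sqrt d / 2)
    {χ : DirichletCharacter ℂ d} {η : ℝ} (hS : IsSiegelZero χ η) (hodd : χ.Odd) (h40 : 40 ≤ η)
    (hη : 3 * Real.log d ^ 2 ≤ η) {β : ℝ} (hβ1 : 1 - 2 / Real.log (Real.sqrt d / 2) ≤ β)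
    (hβ2 : β ≤ 1 - 1 / Real.log (Real.sqrt d / 2)) :
    (χ.LFunction (β : ℂ)).re < 0 ∧ χ.LFunction (β : ℂ) ≠ 0 := by
  set y := Real.sqrt d / 2 with hydef
  have hdR : (10 ^ 4 : ℝ) ≤ d := by exact_mod_cast hd
  have hd0 : (0 : ℝ) < d := by linarith
  have he8 : 0 < Real.exp 8 := Real.exp_pos 8
  have hy0 : 0 < y := lt_of_lt_of_le he8 hy8
  set L := Real.log y with hLdef
  have hL8 : 8 ≤ L := by rw [hLdef, Real.le_log_iff_exp_le hy0]; exact hy8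
  -- `L ≤ ½ log d` (`log(√d/2) = ½ log d − log 2`)
  have hsd0 : 0 < Real.sqrt d := Real.sqrt_pos.2 hd0
  have hLle : L ≤ Real.log d / 2 := by
    rw [hLdef, hydef, Real.log_div hsd0.ne' two_ne_zero, Real.log_sqrt hd0.le]
    have := Real.log_two_gt_d9
    linarith
  have hlogd : 9 ≤ Real.log d := by
    rw [Real.le_log_iff_exp_le hd0]
    have h := Real.exp_one_lt_d9
    have h9 : Real.exp 9 = Real.exp 1 ^ 9 := by rw [← Real.exp_nat_mul]; norm_num
    rw [h9]
    have : Real.exp 1 ^ 9 < 2.7182818286 ^ 9 := by gcongr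
    linarith [show (2.7182818286 : ℝ) ^ 9 < 10 ^ 4 by norm_num]
  have hlogd0 : 0 < Real.log d := by linarith
  obtain ⟨n1, n2, n3⟩ := numerics_two
  -- apply the window theorem with `κ₁ = 1`, `κ₂ = 2`
  have hβ1' : 1 - 2 / Real.log (Real.sqrt d / 2) ≤ β := hβ1
  refine LFunction_neg_on_window_of_isSiegelZero hd hS hodd h40 (κ₁ := 1) (κ₂ := 2) le_rfl (by norm_num)
    (by rw [← hydef, ← hLdef]; linarith) ?_ hβ1' hβ2
  rw [← hydef, ← hLdef]
  -- the point inequality at `κ₂ = 2`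
  have hη0 : 0 < η := by linarith
  -- lower bound for the bracket: `2e^{-2} y/(2L) ≥ 0.2706 y/log d`
  have hb1 : 0.2706 * y / Real.log d ≤ 2 * Real.exp (-2) * y / (2 * L) := by
    rw [div_le_div_iff₀ hlogd0 (by positivity)]
    have h1 : 0.2706 * y * (2 * L) ≤ 0.2706 * y * Real.log d := by
      apply mul_le_mul_of_nonneg_left _ (by positivity); linarith
    have hyl : 0 ≤ y * Real.log d := by positivity
    calc 0.2706 * y * (2 * L) ≤ 0.2706 * y * Real.log d := h1
      _ = 0.2706 * (y * Real.log d) := by ring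
      _ ≤ 2 * Real.exp (-2) * (y * Real.log d) := mul_le_mul_of_nonneg_right n1.le hyl
      _ = 2 * Real.exp (-2) * y * Real.log d := by ring
  -- `2e² − ¾ ≤ 14.03 ≤ 0.0516 y/log d` (from `y ≥ 272 log d`)
  have hb2 : 2 * Real.exp 2 - 3 / 4 ≤ 0.0516 * y / Real.log d := by
    rw [le_div_iff₀ hlogd0]
    nlinarith
  have hbr : 0.219 * y / Real.log d ≤ 2 * Real.exp (-2) * y / (2 * L) - 2 * Real.exp 2 + 3 / 4 := by
    have : 0.219 * y / Real.log d = 0.2706 * y / Real.log d - 0.0516 * y / Real.log d := by ring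
    linarith
  -- `η · bracket ≥ 3 log²d · 0.219 y/log d = 0.657 y log d > (2/π)·y log d`
  have hfin : 2 * y * Real.log d / Real.pi < η * (0.219 * y / Real.log d) := by
    have h1 : 3 * Real.log d ^ 2 * (0.219 * y / Real.log d) ≤ η * (0.219 * y / Real.log d) :=
      mul_le_mul_of_nonneg_right hη (by positivity)
    have h2 : 3 * Real.log d ^ 2 * (0.219 * y / Real.log d) = 0.657 * y * Real.log d := by
      field_simp; ring
    have h3 : 2 * y * Real.log d / Real.pi = 2 / Real.pi * (y * Real.log d) := by ring
    have h4 : 2 / Real.pi * (y * Real.log d) < 0.6367 * (y * Real.log d) :=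
      mul_lt_mul_of_pos_right n3 (by positivity)
    rw [h3]
    nlinarith
  calc 2 * y * Real.log d / Real.pi < η * (0.219 * y / Real.log d) := hfin
    _ ≤ η * (2 * Real.exp (-2) * y / (2 * L) - 2 * Real.exp 2 + 3 / 4) :=
        mul_le_mul_of_nonneg_left hbr hη0.le

end RealPointExit

end Literature.NumberTheory.LFunctions

end
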